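import Mathlib
import HarnessLib
import Summits.Ventures.LatticeQCDFlow.Exactness.NCMCGeneralSpaceOccupancyChainCLT
import Summits.Ventures.LatticeQCDFlow.Exactness.NCMCGeneralSpaceOccupancyChainDoeblinCM

/-!
# END TO END for the SU(N) `lc_sweep` instance: the NCMC lane with Cabibbo–Marinari sweeps between switches has Gaussian `√n`-fluctuations of the occupancy and of `dF_occ` from EVERY initial gauge field, for every `c ≠ ΔF`

HONEST FRAMING: exact (Metropolis-corrected) sampling algorithms for lattice gauge theory;
figures of merit are autocorrelation/cost numbers at stated couplings and volumes; no
continuum-physics claim.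

Venture `LatticeQCDFlow` (cell pub-lqcd), topic `Exactness`; FANOUT row 13 (`eng-snf`, GEN-19).
NEW WORK of the cell, not a published result; no definition is introduced; nothing is cited as a
fact.  ASSEMBLY of GEN-19's NCMC central limit theorems (`NCMCGeneralSpaceOccupancyChainCLT`:
`CrooksPair.ncmc_occupancy_clt_of_exists_sq`, `CrooksPair.ncmc_dFocc_clt_of_exists_sq`) with GEN-18's
unconditional two-step certificate for the SU(N) Cabibbo–Marinari sweep
(`NCMCGeneralSpaceOccupancyChainDoeblinCM`: `wilson_cmSweep_minorising`; `NCMCGeneralSpaceOccupancyChainSweeps`: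
`wilson_cmSweep_package` — row 9's `latSweep` with its explicit `ε • ⊗Haar` minorisation;
`NCMCGeneralSpaceOccupancyChainDoeblinMirror`: `CrooksPair.ncmc_exists_sq_doeblin`, the Jarzynski sign
`CrooksPair.bind_work_ne_ne_zero_of_ne`).  Engine: `latflow-snf`, `correction = ncmc-metropolis`,
between two Wilson couplings on `SU(n)^E` over the periodic lattice `(ℤ/L)^d`, level samplers the
`lc_sweep` (Cabibbo–Marinari) composites, ANY Crooks pair, ANY `c ≠ ΔF`.

## Content

* **`CrooksPair.ncmc_wilsonCMSweep_occupancy_clt_of_ne`** — for every initial state `z` and every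
  `Y ~ N(0, 2 τ_int(ρ_occ) σ(1 − σ))`: `√k (p̂_k − σ(c − ΔF)) ⇒ Y` under `P_{δ_z}`.
* **`CrooksPair.ncmc_wilsonCMSweep_dFocc_clt_of_ne`** — for every `Y ~ N(0, 2 τ_int(ρ_occ)/(σ(1 − σ)))`:
  `√k (dF_occ,k − ΔF) ⇒ Y` under `P_{δ_z}`.

NOT CLAIMED: the value of `τ_int(ρ_occ)` or of the Doeblin constant (measured figures of merit); a
typed consistent estimator of `τ_int`; rates; `c = ΔF` with `W ≡ ΔF`; over-relaxation-only sweeps.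
-/

namespace Summit.Ventures.LatticeQCDFlow.Exactness.GeneralNCMC

open MeasureTheory ProbabilityTheory Set Filter Finset
open scoped ENNReal Topology

section CM

open Literature.MathematicalPhysics.QuantumFieldTheory

variable {n : Type*} [Fintype n] [DecidableEq n] [Nonempty n] [LinearOrder n]
variable {m : Type*} [Fintype m] [DecidableEq m]
variable {d L N : ℕ} (ρ : Matrix.specialUnitaryGroup n ℂ →* Matrix (Fin N) (Fin N) ℂ)

/-- **THE OCCUPANCY CLT FOR THE SU(N) `lc_sweep` INSTANCE, FROM EVERY INITIAL GAUGE FIELD, EVERY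
`c ≠ ΔF`.**  Prior `wilsonWeight ρ β₀`, target `wilsonWeight ρ β₁` on `SU(n)^E`, level samplers the
Cabibbo–Marinari sweeps (frames listing the coordinate pairs lexicographically or reversed, link lists
visiting every edge), ANY Crooks pair, `c ≠ ΔF`: for every initial state `z` and every `Y` with law
`N(0, 2 τ_int(ρ_occ) σ(1 − σ))`, `√k (p̂_k − σ(c − ΔF))` converges in distribution to `Y` under
`P_{δ_z}`. -/
theorem CrooksPair.ncmc_wilsonCMSweep_occupancy_clt_of_ne [NeZero L] (hρ : Continuous ρ) (β₀ β₁ : ℝ)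
    (frames₀ frames₁ : List (n ≃ Fin 2 ⊕ m))
    (hlex₀ : frames₀.map pairOf = lexPairs (Finset.univ.sort (· ≤ ·) : List n) ∨
      frames₀.map pairOf = (lexPairs (Finset.univ.sort (· ≤ ·) : List n)).reverse)
    (hlex₁ : frames₁.map pairOf = lexPairs (Finset.univ.sort (· ≤ ·) : List n) ∨
      frames₁.map pairOf = (lexPairs (Finset.univ.sort (· ≤ ·) : List n)).reverse)
    {links₀ links₁ : List (Edge d L)} (hl₀ : ∀ ed, ed ∈ links₀) (hl₁ : ∀ ed, ed ∈ links₁)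
    {E : Type*} [MeasurableSpace E]
    {κF κR : Kernel (GaugeConfig d L (Matrix.specialUnitaryGroup n ℂ)) E} [IsMarkovKernel κF]
    [IsMarkovKernel κR] {s e : E → GaugeConfig d L (Matrix.specialUnitaryGroup n ℂ)} {W : E → ℝ}
    (h : CrooksPair (wilsonWeight (d := d) (L := L) ρ β₀) (wilsonWeight (d := d) (L := L) ρ β₁)
      κF κR s e W) {c ΔF : ℝ}
    (hΔF : Real.exp (-ΔF) = (((wilsonWeight (d := d) (L := L) ρ β₀) univ)⁻¹ *
      (wilsonWeight (d := d) (L := L) ρ β₁) univ).toReal) (hc : c ≠ ΔF) :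
    ∃ (_ : IsMarkovKernel (switchKernel κF κR c W s e))
      (_ : IsMarkovKernel (levelKernel
        (latSweep (gibbsDensity fun U : GaugeConfig d L (Matrix.specialUnitaryGroup n ℂ) => β₀ * wilsonAction ρ U) frames₀ links₀)
        (latSweep (gibbsDensity fun U : GaugeConfig d L (Matrix.specialUnitaryGroup n ℂ) => β₁ * wilsonAction ρ U) frames₁ links₁))),
      ∀ (z : Bool × GaugeConfig d L (Matrix.specialUnitaryGroup n ℂ))
        [IsProbabilityMeasure (Kernel.trajMeasure (X := fun _ : ℕ => Bool × GaugeConfig d L (Matrix.specialUnitaryGroup n ℂ))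
          (Measure.dirac z)
          (fun k : ℕ => (switchKernel κF κR c W s e ∘ₖ levelKernel
            (latSweep (gibbsDensity fun U : GaugeConfig d L (Matrix.specialUnitaryGroup n ℂ) => β₀ * wilsonAction ρ U) frames₀ links₀)
            (latSweep (gibbsDensity fun U : GaugeConfig d L (Matrix.specialUnitaryGroup n ℂ) => β₁ * wilsonAction ρ U) frames₁ links₁)).comap
            (fun hh : (j : ↥(Finset.Iic k)) → Bool × GaugeConfig d L (Matrix.specialUnitaryGroup n ℂ) =>
              hh ⟨k, Finset.mem_Iic.2 le_rfl⟩) (measurable_pi_apply _)))]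
        {Ω' : Type*} [MeasurableSpace Ω'] {P' : Measure Ω'} [IsProbabilityMeasure P'] {Y : Ω' → ℝ},
        HasLaw Y (gaussianReal 0 (Real.toNNReal
          (2 * Scoring.tauInt (setACF (switchKernel κF κR c W s e ∘ₖ levelKernel
              (latSweep (gibbsDensity fun U : GaugeConfig d L (Matrix.specialUnitaryGroup n ℂ) => β₀ * wilsonAction ρ U) frames₀ links₀)
              (latSweep (gibbsDensity fun U : GaugeConfig d L (Matrix.specialUnitaryGroup n ℂ) => β₁ * wilsonAction ρ U) frames₁ links₁))
            ((jointWeight c (wilsonWeight (d := d) (L := L) ρ β₀)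
                (wilsonWeight (d := d) (L := L) ρ β₁) univ)⁻¹ •
              jointWeight c (wilsonWeight (d := d) (L := L) ρ β₀) (wilsonWeight (d := d) (L := L) ρ β₁))
            (targetLevel (GaugeConfig d L (Matrix.specialUnitaryGroup n ℂ))))
            * (Real.sigmoid (c - ΔF) * (1 - Real.sigmoid (c - ΔF)))))) P' →
        TendstoInDistribution (fun (k : ℕ) (x : ℕ → Bool × GaugeConfig d L (Matrix.specialUnitaryGroup n ℂ)) =>
            Real.sqrt k * ((∑ i ∈ range k, (targetLevel (GaugeConfig d L (Matrix.specialUnitaryGroup n ℂ))).indicator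
              (1 : Bool × GaugeConfig d L (Matrix.specialUnitaryGroup n ℂ) → ℝ) (x i)) / k - Real.sigmoid (c - ΔF)))
          atTop Y (fun _ => Kernel.trajMeasure (X := fun _ : ℕ => Bool × GaugeConfig d L (Matrix.specialUnitaryGroup n ℂ))
            (Measure.dirac z)
            (fun k : ℕ => (switchKernel κF κR c W s e ∘ₖ levelKernel
              (latSweep (gibbsDensity fun U : GaugeConfig d L (Matrix.specialUnitaryGroup n ℂ) => β₀ * wilsonAction ρ U) frames₀ links₀)
              (latSweep (gibbsDensity fun U : GaugeConfig d L (Matrix.specialUnitaryGroup n ℂ) => β₁ * wilsonAction ρ U) frames₁ links₁)).comap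
              (fun hh : (j : ↥(Finset.Iic k)) → Bool × GaugeConfig d L (Matrix.specialUnitaryGroup n ℂ) =>
                hh ⟨k, Finset.mem_Iic.2 le_rfl⟩) (measurable_pi_apply _))) P' := by
  obtain ⟨hMk₀, hfin₀, -, -, h0, -, hK₀, -⟩ := wilson_cmSweep_package ρ hρ β₀ frames₀ hlex₀ hl₀
  obtain ⟨hMk₁, hfin₁, -, -, h1, -, hK₁, -⟩ := wilson_cmSweep_package ρ hρ β₁ frames₁ hlex₁ hl₁
  obtain ⟨m₀, hmfin₀, hm₀, hmin₀, hac₀⟩ := wilson_cmSweep_minorising ρ hρ β₀ frames₀ hlex₀ hl₀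
  obtain ⟨m₁, hmfin₁, hm₁, hmin₁, hac₁⟩ := wilson_cmSweep_minorising ρ hρ β₁ frames₁ hlex₁ hl₁
  haveI := hMk₀
  haveI := hMk₁
  haveI := hfin₀
  haveI := hfin₁
  haveI := hmfin₀
  haveI := hmfin₁
  refine ⟨isMarkovKernel_switchKernel (κF := κF) (κR := κR) (c := c)
      h.measurable_W h.measurable_s h.measurable_e, isMarkovKernel_levelKernel _ _,
    fun z _ Ω' _ P' _ Y hY => ?_⟩
  exact h.ncmc_occupancy_clt_of_exists_sq h0 h1 hK₀ hK₁
    (h.ncmc_exists_sq_doeblin hm₀ hm₁ hmin₀ hmin₁ hac₀ hac₁ c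
      (h.bind_work_ne_ne_zero_of_ne h0 hΔF hc)) hΔF z hY

/-- **THE `dF_occ` CLT FOR THE SU(N) `lc_sweep` INSTANCE, FROM EVERY INITIAL GAUGE FIELD, EVERY
`c ≠ ΔF`**: for every initial state `z` and every `Y ~ N(0, 2 τ_int(ρ_occ)/(σ(1 − σ)))`,
`√k (dF_occ,k − ΔF)` converges in distribution to `Y` under `P_{δ_z}`. -/
theorem CrooksPair.ncmc_wilsonCMSweep_dFocc_clt_of_ne [NeZero L] (hρ : Continuous ρ) (β₀ β₁ : ℝ)
    (frames₀ frames₁ : List (n ≃ Fin 2 ⊕ m))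
    (hlex₀ : frames₀.map pairOf = lexPairs (Finset.univ.sort (· ≤ ·) : List n) ∨
      frames₀.map pairOf = (lexPairs (Finset.univ.sort (· ≤ ·) : List n)).reverse)
    (hlex₁ : frames₁.map pairOf = lexPairs (Finset.univ.sort (· ≤ ·) : List n) ∨
      frames₁.map pairOf = (lexPairs (Finset.univ.sort (· ≤ ·) : List n)).reverse)
    {links₀ links₁ : List (Edge d L)} (hl₀ : ∀ ed, ed ∈ links₀) (hl₁ : ∀ ed, ed ∈ links₁)
    {E : Type*} [MeasurableSpace E]
    {κF κR : Kernel (GaugeConfig d L (Matrix.specialUnitaryGroup n ℂ)) E} [IsMarkovKernel κF]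
    [IsMarkovKernel κR] {s e : E → GaugeConfig d L (Matrix.specialUnitaryGroup n ℂ)} {W : E → ℝ}
    (h : CrooksPair (wilsonWeight (d := d) (L := L) ρ β₀) (wilsonWeight (d := d) (L := L) ρ β₁)
      κF κR s e W) {c ΔF : ℝ}
    (hΔF : Real.exp (-ΔF) = (((wilsonWeight (d := d) (L := L) ρ β₀) univ)⁻¹ *
      (wilsonWeight (d := d) (L := L) ρ β₁) univ).toReal) (hc : c ≠ ΔF) :
    ∃ (_ : IsMarkovKernel (switchKernel κF κR c W s e))
      (_ : IsMarkovKernel (levelKernel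
        (latSweep (gibbsDensity fun U : GaugeConfig d L (Matrix.specialUnitaryGroup n ℂ) => β₀ * wilsonAction ρ U) frames₀ links₀)
        (latSweep (gibbsDensity fun U : GaugeConfig d L (Matrix.specialUnitaryGroup n ℂ) => β₁ * wilsonAction ρ U) frames₁ links₁))),
      ∀ (z : Bool × GaugeConfig d L (Matrix.specialUnitaryGroup n ℂ))
        [IsProbabilityMeasure (Kernel.trajMeasure (X := fun _ : ℕ => Bool × GaugeConfig d L (Matrix.specialUnitaryGroup n ℂ))
          (Measure.dirac z)
          (fun k : ℕ => (switchKernel κF κR c W s e ∘ₖ levelKernel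
            (latSweep (gibbsDensity fun U : GaugeConfig d L (Matrix.specialUnitaryGroup n ℂ) => β₀ * wilsonAction ρ U) frames₀ links₀)
            (latSweep (gibbsDensity fun U : GaugeConfig d L (Matrix.specialUnitaryGroup n ℂ) => β₁ * wilsonAction ρ U) frames₁ links₁)).comap
            (fun hh : (j : ↥(Finset.Iic k)) → Bool × GaugeConfig d L (Matrix.specialUnitaryGroup n ℂ) =>
              hh ⟨k, Finset.mem_Iic.2 le_rfl⟩) (measurable_pi_apply _)))]
        {Ω' : Type*} [MeasurableSpace Ω'] {P' : Measure Ω'} [IsProbabilityMeasure P'] {Y : Ω' → ℝ},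
        HasLaw Y (gaussianReal 0 (Real.toNNReal
          (2 * Scoring.tauInt (setACF (switchKernel κF κR c W s e ∘ₖ levelKernel
              (latSweep (gibbsDensity fun U : GaugeConfig d L (Matrix.specialUnitaryGroup n ℂ) => β₀ * wilsonAction ρ U) frames₀ links₀)
              (latSweep (gibbsDensity fun U : GaugeConfig d L (Matrix.specialUnitaryGroup n ℂ) => β₁ * wilsonAction ρ U) frames₁ links₁))
            ((jointWeight c (wilsonWeight (d := d) (L := L) ρ β₀)
                (wilsonWeight (d := d) (L := L) ρ β₁) univ)⁻¹ •
              jointWeight c (wilsonWeight (d := d) (L := L) ρ β₀) (wilsonWeight (d := d) (L := L) ρ β₁))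
            (targetLevel (GaugeConfig d L (Matrix.specialUnitaryGroup n ℂ))))
            / (Real.sigmoid (c - ΔF) * (1 - Real.sigmoid (c - ΔF)))))) P' →
        TendstoInDistribution (fun (k : ℕ) (x : ℕ → Bool × GaugeConfig d L (Matrix.specialUnitaryGroup n ℂ)) =>
            Real.sqrt k * ((c - Real.log
              ((∑ i ∈ range k, (targetLevel (GaugeConfig d L (Matrix.specialUnitaryGroup n ℂ))).indicator
                  (1 : Bool × GaugeConfig d L (Matrix.specialUnitaryGroup n ℂ) → ℝ) (x i)) / k /
                (1 - (∑ i ∈ range k, (targetLevel (GaugeConfig d L (Matrix.specialUnitaryGroup n ℂ))).indicator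
                  (1 : Bool × GaugeConfig d L (Matrix.specialUnitaryGroup n ℂ) → ℝ) (x i)) / k))) - ΔF))
          atTop Y (fun _ => Kernel.trajMeasure (X := fun _ : ℕ => Bool × GaugeConfig d L (Matrix.specialUnitaryGroup n ℂ))
            (Measure.dirac z)
            (fun k : ℕ => (switchKernel κF κR c W s e ∘ₖ levelKernel
              (latSweep (gibbsDensity fun U : GaugeConfig d L (Matrix.specialUnitaryGroup n ℂ) => β₀ * wilsonAction ρ U) frames₀ links₀)
              (latSweep (gibbsDensity fun U : GaugeConfig d L (Matrix.specialUnitaryGroup n ℂ) => β₁ * wilsonAction ρ U) frames₁ links₁)).comap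
              (fun hh : (j : ↥(Finset.Iic k)) → Bool × GaugeConfig d L (Matrix.specialUnitaryGroup n ℂ) =>
                hh ⟨k, Finset.mem_Iic.2 le_rfl⟩) (measurable_pi_apply _))) P' := by
  obtain ⟨hMk₀, hfin₀, -, -, h0, -, hK₀, -⟩ := wilson_cmSweep_package ρ hρ β₀ frames₀ hlex₀ hl₀
  obtain ⟨hMk₁, hfin₁, -, -, h1, -, hK₁, -⟩ := wilson_cmSweep_package ρ hρ β₁ frames₁ hlex₁ hl₁
  obtain ⟨m₀, hmfin₀, hm₀, hmin₀, hac₀⟩ := wilson_cmSweep_minorising ρ hρ β₀ frames₀ hlex₀ hl₀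
  obtain ⟨m₁, hmfin₁, hm₁, hmin₁, hac₁⟩ := wilson_cmSweep_minorising ρ hρ β₁ frames₁ hlex₁ hl₁
  haveI := hMk₀
  haveI := hMk₁
  haveI := hfin₀
  haveI := hfin₁
  haveI := hmfin₀
  haveI := hmfin₁
  refine ⟨isMarkovKernel_switchKernel (κF := κF) (κR := κR) (c := c)
      h.measurable_W h.measurable_s h.measurable_e, isMarkovKernel_levelKernel _ _,
    fun z _ Ω' _ P' _ Y hY => ?_⟩
  exact h.ncmc_dFocc_clt_of_exists_sq h0 h1 hK₀ hK₁
    (h.ncmc_exists_sq_doeblin hm₀ hm₁ hmin₀ hmin₁ hac₀ hac₁ c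
      (h.bind_work_ne_ne_zero_of_ne h0 hΔF hc)) hΔF z hY

end CM

end Summit.Ventures.LatticeQCDFlow.Exactness.GeneralNCMC
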